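import Mathlib
import HarnessLib
import Summits.CriticalPhenomena.PercolationContinuityZ3.Theorems.PercNearOneGluingNoHeavyQuantFarDecChain

/-!
# QUANT lane R8, front "FAR beyond trees", layer one — the ONE-VERTEX DECOUPLING STEP reduced to ONE RATIO INEQUALITY
# (law level, pure real algebra)

builds on p205010 (kernel theorem, internal audit signed; external expert review pending)

Support file (`--supports stmt-CriticalPhenomena-4575`), seat `prim-quant-p1` (gen 21); memo
`run/shared/lean/prim/quant/prim-quant-p1-g21/FOR-LEAD-CYCDEC.md` §2.  Pure real algebra; standard axioms; no sorries; no
definitions.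

Setting (memo §1–§2).  A pendant block whose hubs `1, …, k` are reached by two REVERSED independent arms (a pendant cycle),
hub `i` carrying an independent count `W_i` with law `(z_i, s_i, d_i)` on `{0, 1, ≥ 2}`, `u_i = s_i + d_i`, marginal
`m_i = P(i ∈ R)`.  Decoupling hub `1` (replacing its membership indicator `I_1` by an independent `Bernoulli(m_1)`) changes the
block numbers `(h, t) = (P(X ≥ 1), P(X ≥ 2))` into `(h', t')` with
`h' = m_1u_1 + (1 − m_1u_1)H`, `t' = m_1d_1 + m_1s_1H + (1 − m_1u_1)T`, `h = h' − u_1σ`, `t = t' + s_1σ − u_1π`,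
where `H = P(X° ≥ 1)`, `T = P(X° ≥ 2)` are the levels of the count `X°` of the other hubs and
`σ = Cov(I_1, 𝟙[X° ≥ 1]) ≥ 0`, `π = Cov(I_1, 𝟙[X° ≥ 2]) ≥ 0` (Harris).  Model facts: `σ ≤ m_1(1 − H)`, `T ≤ t`,
`μ ≤ h`, `m_1u_1H + u_1σ ≤ t` (the last three: `X ≥ X°`, `h ≥ m_iu_i`, `t ≥ P(1 ∈ R, W_1 ≥ 1, X° ≥ 1)`), `q ≤ H`
(`H ≥ m_iu_i` for every other hub), where `q = min_{i ≥ 2} m_iu_i` and the exit point is `μ = min(m_1u_1, q)`.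

THE STEP THEOREM (`Block.dominates_hubStep`): under these facts, the single RATIO INEQUALITY

  `(C)   π · q · (1 − H) ≤ σ · T · (1 − q)`

implies that `S = (h, t)` dominates a mixture of `S' = (h', t')` and `Q = (μ, μ)` — i.e. the one-vertex decoupling step
`DEC_{v_1}` of the k-anchor programme (p1 g19 memo §6, p1 g20 memo §1), both its `(U)` part and its `(P1)` part.  The ratio
inequality `(C)` is proved at the law level in the memo (§3–§4: it is an inequality between two increments of the same
boosted arm, settled by an explicit pairing argument); this file is the algebra that turns `(C)` into the domination.
Ingredients: `hubStep_F_caseA1` / `hubStep_F_caseA2` (`t' < μ ⟹ F(μ) ≥ 0`, the two cases `μ = m_1u_1` / `μ = q`, each an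
explicit polynomial identity), `hubStep_exit_caseB1` / `hubStep_exit_caseB2` (`t' ≥ μ ⟹ t ≥ μ`), `dominates_mono_q`
(the exit point may be lowered), and the assembly.
[this work]
-/

namespace Summit.CriticalPhenomena.PercolationContinuityZ3.Theorems

namespace Quant

namespace Block

/-- **Lowering the exit point.**  If `S` dominates a mixture of `S'` and `Q = (q, q)` then it dominates a mixture of `S'` and
`Q̃ = (q', q')` for every `q' ≤ q` (same `λ`). [this work] -/
theorem dominates_mono_q (q q' hS tS hP tP : ℝ) (hq : q' ≤ q)
    (H : ∃ l : ℝ, 0 ≤ l ∧ l ≤ 1 ∧ l * hP + (1 - l) * q ≤ hS ∧ l * tP + (1 - l) * q ≤ tS) :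
    ∃ l : ℝ, 0 ≤ l ∧ l ≤ 1 ∧ l * hP + (1 - l) * q' ≤ hS ∧ l * tP + (1 - l) * q' ≤ tS := by
  obtain ⟨l, h0, h1, hh, ht⟩ := H
  have e : (1 - l) * q' ≤ (1 - l) * q := mul_le_mul_of_nonneg_left hq (by linarith)
  exact ⟨l, h0, h1, by linarith, by linarith⟩

/-- **Case A1 of the step** (`μ = m u ≤ q`, interpolation regime `t' < μ`): the tight-first-coordinate quantity
`F = (t − t')(h' − μ) − (h' − h)(μ − t') = (sσ − uπ)·(1 − mu)H − uσ·(ms(1 − H) − (1 − mu)T)` is `≥ 0`.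
Proof: `F·q(1−H) = σ·{s(1−H)H(q − mu) + (H − q)·u·V} + u(1−mu)H·(σT(1−q) − πq(1−H))` with `V = ms(1−H) − (1−mu)T > 0`
the regime margin; every term is `≥ 0` by `(C)`, `mu ≤ q ≤ H`. [this work] -/
theorem hubStep_F_caseA1 (m u s d q H T σ π : ℝ)
    (hm0 : 0 ≤ m) (hs : 0 ≤ s) (hd : 0 ≤ d) (hu : s + d = u)
    (hq0 : 0 ≤ q) (hqH : q ≤ H) (hH1 : H ≤ 1) (hT0 : 0 ≤ T)
    (hσ : 0 ≤ σ) (hC : π * q * (1 - H) ≤ σ * T * (1 - q))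
    (hcase : m * u ≤ q) (hreg : m * d + m * s * H + (1 - m * u) * T < m * u) :
    0 ≤ (s * σ - u * π) * ((m * u + (1 - m * u) * H) - m * u)
        - u * σ * (m * u - (m * d + m * s * H + (1 - m * u) * T)) := by
  -- the regime margin
  set V := m * s * (1 - H) - (1 - m * u) * T with hV
  have hVpos : 0 < V := by
    have : m * u - (m * d + m * s * H + (1 - m * u) * T) = V := by rw [hV, ← hu]; ring
    linarith
  have hu0 : 0 ≤ u := by linarith
  -- `q > 0` and `H < 1` follow from the regime
  have hH0 : 0 ≤ H := le_trans hq0 hqH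
  have hmu_pos : 0 < m * u := by
    have h1 : 0 ≤ m * d := mul_nonneg hm0 hd
    have h2 : 0 ≤ m * s * H := mul_nonneg (mul_nonneg hm0 hs) hH0
    have h3 : 0 ≤ (1 - m * u) * T := mul_nonneg (by linarith) hT0
    linarith
  have hq_pos : 0 < q := lt_of_lt_of_le hmu_pos hcase
  have hH_lt : H < 1 := by
    by_contra hH
    have hH' : H = 1 := le_antisymm hH1 (not_lt.mp hH)
    have : V ≤ 0 := by
      rw [hV, hH']; simp only [sub_self, mul_zero, zero_sub, neg_nonpos]
      exact mul_nonneg (by linarith) hT0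
    linarith
  have hqH0 : 0 < q * (1 - H) := mul_pos hq_pos (by linarith)
  -- the identity
  have hid : ((s * σ - u * π) * ((m * u + (1 - m * u) * H) - m * u)
        - u * σ * (m * u - (m * d + m * s * H + (1 - m * u) * T))) * (q * (1 - H))
      = σ * (s * (1 - H) * H * (q - m * u) + (H - q) * u * V)
        + u * ((1 - m * u) * H) * (σ * T * (1 - q) - π * q * (1 - H)) := by
    rw [hV, ← hu]; ring
  have t1 : 0 ≤ s * (1 - H) * H * (q - m * u) :=
    mul_nonneg (mul_nonneg (mul_nonneg hs (by linarith)) hH0) (by linarith)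
  have t2 : 0 ≤ (H - q) * u * V := mul_nonneg (mul_nonneg (by linarith) hu0) hVpos.le
  have t3 : 0 ≤ u * ((1 - m * u) * H) * (σ * T * (1 - q) - π * q * (1 - H)) :=
    mul_nonneg (mul_nonneg hu0 (mul_nonneg (by linarith) hH0)) (by linarith)
  have hprod : 0 ≤ ((s * σ - u * π) * ((m * u + (1 - m * u) * H) - m * u)
        - u * σ * (m * u - (m * d + m * s * H + (1 - m * u) * T))) * (q * (1 - H)) := by
    rw [hid]; exact add_nonneg (mul_nonneg hσ (add_nonneg t1 t2)) t3
  exact (mul_nonneg_iff_of_pos_right hqH0).mp hprod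

/-- **Case A2 of the step** (`μ = q < m u`, interpolation regime `t' < q`):
`F = (sσ − uπ)·W − uσ·V ≥ 0` with `W = h' − q = (H − q) + mu(1 − H)` and `V = q − t' = q − mu + ms(1−H) − (1−mu)T > 0`.
Proof: `F·q(1−H) = σΓ + uW(σT(1−q) − πq(1−H))` and `m(1−H)·Γ = V·q(1−H)(H−q) + (1−H)·W·(mu − q)(q − T)`, all terms
`≥ 0` (`T ≤ t' < q`). [this work] -/
theorem hubStep_F_caseA2 (m u s d q H T σ π : ℝ)
    (hm0 : 0 ≤ m) (hm1 : m ≤ 1) (hs : 0 ≤ s) (hd : 0 ≤ d) (hu : s + d = u) (hu1 : u ≤ 1)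
    (hqH : q ≤ H) (hH1 : H ≤ 1) (hT0 : 0 ≤ T) (hTH : T ≤ H)
    (hσ : 0 ≤ σ) (hσ1 : σ ≤ m * (1 - H)) (hC : π * q * (1 - H) ≤ σ * T * (1 - q))
    (hcase : q < m * u) (hreg : m * d + m * s * H + (1 - m * u) * T < q) :
    0 ≤ (s * σ - u * π) * ((m * u + (1 - m * u) * H) - q)
        - u * σ * (q - (m * d + m * s * H + (1 - m * u) * T)) := by
  set W := (H - q) + m * u * (1 - H) with hW
  set V := q - m * u + m * s * (1 - H) - (1 - m * u) * T with hV
  have hu0 : 0 ≤ u := by linarith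
  have hmu1 : m * u ≤ 1 := by nlinarith
  have hW' : (m * u + (1 - m * u) * H) - q = W := by rw [hW]; ring
  have hV' : q - (m * d + m * s * H + (1 - m * u) * T) = V := by rw [hV, ← hu]; ring
  have hVpos : 0 < V := by rw [← hV']; linarith
  -- `T ≤ t' < q`, `m > 0`, `H < 1`
  have htT : T ≤ m * d + m * s * H + (1 - m * u) * T := by
    have : m * d + m * s * H + (1 - m * u) * T - T = m * d * (1 - T) + m * s * (H - T) := by rw [← hu]; ring
    have h1 : 0 ≤ m * d * (1 - T) := mul_nonneg (mul_nonneg hm0 hd) (by linarith)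
    have h2 : 0 ≤ m * s * (H - T) := mul_nonneg (mul_nonneg hm0 hs) (by linarith)
    linarith
  have hTq : T < q := lt_of_le_of_lt htT hreg
  have hq_pos : 0 < q := lt_of_le_of_lt hT0 hTq
  have hm_pos : 0 < m := by
    rcases eq_or_lt_of_le hm0 with h | h
    · exfalso; rw [← h] at hcase; simp at hcase; linarith
    · exact h
  have hH_lt : H < 1 := by
    by_contra hH
    have hH' : H = 1 := le_antisymm hH1 (not_lt.mp hH)
    -- then t' = mu + (1 - mu) T ≥ mu > q
    have : m * d + m * s * H + (1 - m * u) * T ≥ m * u := by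
      rw [hH', ← hu]; nlinarith [mul_nonneg (sub_nonneg.mpr hmu1) hT0]
    linarith
  have hqH0 : 0 < q * (1 - H) := mul_pos hq_pos (by linarith)
  have hmH0 : 0 < m * (1 - H) := mul_pos hm_pos (by linarith)
  have hW0 : 0 ≤ W := by rw [hW]; nlinarith [mul_nonneg hm0 hu0]
  -- Γ and its identity
  set Γ := s * W * q * (1 - H) - u * W * T * (1 - q) - u * V * q * (1 - H) with hΓ
  have hidΓ : m * (1 - H) * Γ = V * q * (1 - H) * (H - q) + (1 - H) * W * (m * u - q) * (q - T) := by
    rw [hΓ, hW, hV]; ring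
  have hΓ0 : 0 ≤ Γ := by
    have r1 : 0 ≤ V * q * (1 - H) * (H - q) := mul_nonneg (mul_nonneg (mul_nonneg hVpos.le hq_pos.le) (by linarith)) (by linarith)
    have r2 : 0 ≤ (1 - H) * W * (m * u - q) * (q - T) :=
      mul_nonneg (mul_nonneg (mul_nonneg (by linarith) hW0) (by linarith)) (by linarith)
    have : 0 ≤ m * (1 - H) * Γ := by rw [hidΓ]; exact add_nonneg r1 r2
    exact (mul_nonneg_iff_of_pos_left hmH0).mp this
  have hid : ((s * σ - u * π) * W - u * σ * V) * (q * (1 - H)) = σ * Γ + u * W * (σ * T * (1 - q) - π * q * (1 - H)) := by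
    rw [hΓ]; ring
  have t3 : 0 ≤ u * W * (σ * T * (1 - q) - π * q * (1 - H)) := mul_nonneg (mul_nonneg hu0 hW0) (by linarith)
  have hprod : 0 ≤ ((s * σ - u * π) * W - u * σ * V) * (q * (1 - H)) := by
    rw [hid]; exact add_nonneg (mul_nonneg hσ hΓ0) t3
  rw [hW', hV']
  exact (mul_nonneg_iff_of_pos_right hqH0).mp hprod

/-- **Case B1 of the step** (`μ = m u ≤ q`, exit regime `t' ≥ m u`): `t ≥ m u`.
Proof: if `q(1−H) = 0` use `t ≥ T` (`q = 0`) or `t ≥ muH + uσ` (`H = 1`); otherwise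
`(t − mu)·q(1−H) ≥ Φ(q)`, `Φ` affine non-decreasing in `q` with `Φ(mu) = u·(t' − mu)·(m(1−H) − σ) ≥ 0`. [this work] -/
theorem hubStep_exit_caseB1 (m u s d q H T σ π t : ℝ)
    (hs : 0 ≤ s) (hd : 0 ≤ d) (hu : s + d = u)
    (hq0 : 0 ≤ q) (hH1 : H ≤ 1) (hT0 : 0 ≤ T)
    (hσ : 0 ≤ σ) (hσ1 : σ ≤ m * (1 - H)) (hC : π * q * (1 - H) ≤ σ * T * (1 - q))
    (ht : t = (m * d + m * s * H + (1 - m * u) * T) + s * σ - u * π)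
    (htT : T ≤ t) (ht6 : m * u * H + u * σ ≤ t)
    (hcase : m * u ≤ q) (hexit : m * u ≤ m * d + m * s * H + (1 - m * u) * T) :
    m * u ≤ t := by
  have hu0 : 0 ≤ u := by linarith
  -- degenerate cases
  rcases eq_or_lt_of_le hq0 with hq | hq
  · -- q = 0 ⟹ mu = 0 ≤ T ≤ t
    have : m * u ≤ 0 := by rw [hq]; exact hcase
    linarith
  rcases eq_or_lt_of_le hH1 with hH | hH
  · -- H = 1
    have : m * u * H = m * u := by rw [hH, mul_one]
    nlinarith [mul_nonneg hu0 hσ]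
  have hqH0 : 0 < q * (1 - H) := mul_pos hq (by linarith)
  -- V ≤ 0 is the exit hypothesis
  set V := m * s * (1 - H) - (1 - m * u) * T with hV
  have hV' : m * u - (m * d + m * s * H + (1 - m * u) * T) = V := by rw [hV, ← hu]; ring
  have hVle : V ≤ 0 := by rw [← hV']; linarith
  -- (t - mu) q (1-H) ≥ Φ(q) := (-V + sσ) q (1-H) - uσ T (1-q)
  have h1 : (t - m * u) * (q * (1 - H)) = (-V + s * σ) * q * (1 - H) - u * (π * q * (1 - H)) := by
    rw [ht, hV, ← hu]; ring
  have h2 : (t - m * u) * (q * (1 - H)) ≥ (-V + s * σ) * q * (1 - H) - u * (σ * T * (1 - q)) := by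
    rw [h1]; nlinarith [mul_le_mul_of_nonneg_left hC hu0]
  -- Φ(q) ≥ Φ(mu) + (q - mu)·slope, slope ≥ 0 ; Φ(mu) = u (-V) (m(1-H) - σ)
  have hid : (-V + s * σ) * q * (1 - H) - u * (σ * T * (1 - q))
      = u * (-V) * (m * (1 - H) - σ) + (q - m * u) * ((-V + s * σ) * (1 - H) + u * σ * T) := by
    rw [hV, ← hu]; ring
  have p1 : 0 ≤ u * (-V) * (m * (1 - H) - σ) := mul_nonneg (mul_nonneg hu0 (by linarith)) (by linarith)
  have p2 : 0 ≤ (q - m * u) * ((-V + s * σ) * (1 - H) + u * σ * T) := by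
    have : 0 ≤ (-V + s * σ) * (1 - H) + u * σ * T :=
      add_nonneg (mul_nonneg (by nlinarith [mul_nonneg hs hσ]) (by linarith)) (mul_nonneg (mul_nonneg hu0 hσ) hT0)
    exact mul_nonneg (by linarith) this
  have : 0 ≤ (t - m * u) * (q * (1 - H)) := by linarith [h2, hid, p1, p2]
  have := (mul_nonneg_iff_of_pos_right hqH0).mp this
  linarith

/-- **Case B2 of the step** (`μ = q < m u`, exit regime `t' ≥ q`): `t ≥ q`.
Proof: if `T ≥ q` use `t ≥ T`; if `H = 1` use `t ≥ muH + uσ ≥ mu > q`; otherwise `(t − q)·q(1−H) ≥ Φ`, `Φ` affine in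
`σ ∈ [0, m(1−H)]` with `m(1−H)·Φ = (m(1−H) − σ)·(t' − q)q(1−H) + σ(1−H)(mu − q)(q − T) ≥ 0`. [this work] -/
theorem hubStep_exit_caseB2 (m u s d q H T σ π t : ℝ)
    (hm0 : 0 ≤ m) (hm1 : m ≤ 1) (hs : 0 ≤ s) (hd : 0 ≤ d) (hu : s + d = u) (hu1 : u ≤ 1)
    (hH1 : H ≤ 1) (hT0 : 0 ≤ T)
    (hσ : 0 ≤ σ) (hσ1 : σ ≤ m * (1 - H)) (hC : π * q * (1 - H) ≤ σ * T * (1 - q))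
    (ht : t = (m * d + m * s * H + (1 - m * u) * T) + s * σ - u * π)
    (htT : T ≤ t) (ht6 : m * u * H + u * σ ≤ t)
    (hcase : q < m * u) (hexit : q ≤ m * d + m * s * H + (1 - m * u) * T) :
    q ≤ t := by
  have hu0 : 0 ≤ u := by linarith
  have hmu1 : m * u ≤ 1 := by nlinarith
  by_cases hTq : q ≤ T
  · linarith
  have hTq' : T < q := not_le.mp hTq
  have hq_pos : 0 < q := lt_of_le_of_lt hT0 hTq'
  rcases eq_or_lt_of_le hH1 with hH | hH
  · have : m * u * H = m * u := by rw [hH, mul_one]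
    nlinarith [mul_nonneg hu0 hσ]
  have hqH0 : 0 < q * (1 - H) := mul_pos hq_pos (by linarith)
  have hm_pos : 0 < m := by
    rcases eq_or_lt_of_le hm0 with h | h
    · exfalso; rw [← h] at hcase; simp at hcase; linarith
    · exact h
  have hmH0 : 0 < m * (1 - H) := mul_pos hm_pos (by linarith)
  set V := q - m * u + m * s * (1 - H) - (1 - m * u) * T with hV
  have hV' : q - (m * d + m * s * H + (1 - m * u) * T) = V := by rw [hV, ← hu]; ring
  have hVle : V ≤ 0 := by rw [← hV']; linarith
  have h1 : (t - q) * (q * (1 - H)) = (-V + s * σ) * q * (1 - H) - u * (π * q * (1 - H)) := by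
    rw [ht, hV, ← hu]; ring
  have h2 : (t - q) * (q * (1 - H)) ≥ (-V + s * σ) * q * (1 - H) - u * (σ * T * (1 - q)) := by
    rw [h1]; nlinarith [mul_le_mul_of_nonneg_left hC hu0]
  have hid : m * (1 - H) * ((-V + s * σ) * q * (1 - H) - u * (σ * T * (1 - q)))
      = (m * (1 - H) - σ) * ((-V) * q * (1 - H)) + σ * (1 - H) * (m * u - q) * (q - T) := by
    rw [hV]; ring
  have p1 : 0 ≤ (m * (1 - H) - σ) * ((-V) * q * (1 - H)) :=
    mul_nonneg (by linarith) (mul_nonneg (mul_nonneg (by linarith) hq_pos.le) (by linarith))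
  have p2 : 0 ≤ σ * (1 - H) * (m * u - q) * (q - T) :=
    mul_nonneg (mul_nonneg (mul_nonneg hσ (by linarith)) (by linarith)) (by linarith)
  have h3 : 0 ≤ m * (1 - H) * ((-V + s * σ) * q * (1 - H) - u * (σ * T * (1 - q))) := by rw [hid]; exact add_nonneg p1 p2
  have h4 : 0 ≤ (-V + s * σ) * q * (1 - H) - u * (σ * T * (1 - q)) := (mul_nonneg_iff_of_pos_left hmH0).mp h3
  have : 0 ≤ (t - q) * (q * (1 - H)) := by linarith
  have := (mul_nonneg_iff_of_pos_right hqH0).mp this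
  linarith

/-- **THE ONE-VERTEX DECOUPLING STEP FROM THE RATIO INEQUALITY (C)** (memo §2).  Hub `1` of a pendant block with
two reversed arms: law `(z, s, d)` of its count (`u = s + d`), marginal `m`; `H, T` the levels `P(X° ≥ 1), P(X° ≥ 2)` of the
other hubs' count; `σ = Cov(I_1, 𝟙[X° ≥ 1])`, `π = Cov(I_1, 𝟙[X° ≥ 2])`; `q = min_{i ≥ 2} m_iu_i`.  Model facts as
hypotheses: `0 ≤ σ ≤ m(1 − H)`, `0 ≤ π`, `q ≤ H ≤ 1`, `0 ≤ T ≤ H`, and for the true numbers `h = h' − uσ`,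
`t = t' + sσ − uπ` (`h' = mu + (1 − mu)H`, `t' = md + msH + (1 − mu)T` the numbers after decoupling): `T ≤ t`,
`min(mu, q) ≤ h`, `muH + uσ ≤ t`.  CONCLUSION: if the ratio inequality `(C) π·q·(1 − H) ≤ σ·T·(1 − q)` holds, then `S = (h, t)`
dominates a mixture of `S' = (h', t')` and the exit point `Q = (μ, μ)`, `μ = min(mu, q)`:
`∃ λ ∈ [0,1], λh' + (1−λ)μ ≤ h ∧ λt' + (1−λ)μ ≤ t`.  With `dominates_trans`, `dominates_noise`, `dominates_mono_q` this is the
inductive step of CYC-DEC (memo §5). [this work] -/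
theorem dominates_hubStep (m u s d q H T σ π h t : ℝ)
    (hm0 : 0 ≤ m) (hm1 : m ≤ 1) (hs : 0 ≤ s) (hd : 0 ≤ d) (hu : s + d = u) (hu1 : u ≤ 1)
    (hq0 : 0 ≤ q) (hqH : q ≤ H) (hH1 : H ≤ 1) (hT0 : 0 ≤ T) (hTH : T ≤ H)
    (hσ : 0 ≤ σ) (hσ1 : σ ≤ m * (1 - H)) (hπ : 0 ≤ π) (hC : π * q * (1 - H) ≤ σ * T * (1 - q))
    (hh : h = (m * u + (1 - m * u) * H) - u * σ)
    (ht : t = (m * d + m * s * H + (1 - m * u) * T) + s * σ - u * π)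
    (htT : T ≤ t) (hμh : min (m * u) q ≤ h) (ht6 : m * u * H + u * σ ≤ t) :
    ∃ l : ℝ, 0 ≤ l ∧ l ≤ 1 ∧
      l * (m * u + (1 - m * u) * H) + (1 - l) * min (m * u) q ≤ h ∧
      l * (m * d + m * s * H + (1 - m * u) * T) + (1 - l) * min (m * u) q ≤ t := by
  have hu0 : 0 ≤ u := by linarith
  have hmu1 : m * u ≤ 1 := by nlinarith
  set hP := m * u + (1 - m * u) * H with hhP
  set tP := m * d + m * s * H + (1 - m * u) * T with htP
  set μ := min (m * u) q with hμ
  have hH0 : 0 ≤ H := le_trans hq0 hqH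
  have hhle : h ≤ hP := by rw [hh]; nlinarith [mul_nonneg hu0 hσ]
  -- exit regime: t' ≥ μ ⟹ t ≥ μ ⟹ λ = 0
  by_cases hex : μ ≤ tP
  · have htμ : μ ≤ t := by
      rcases le_or_gt (m * u) q with hc | hc
      · have hμe : μ = m * u := by rw [hμ]; exact min_eq_left hc
        rw [hμe] at hex ⊢
        exact hubStep_exit_caseB1 m u s d q H T σ π t hs hd hu hq0 hH1 hT0 hσ hσ1 hC ht htT ht6 hc hex
      · have hμe : μ = q := by rw [hμ]; exact min_eq_right hc.le
        rw [hμe] at hex ⊢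
        exact hubStep_exit_caseB2 m u s d q H T σ π t hm0 hm1 hs hd hu hu1 hH1 hT0 hσ hσ1 hC ht htT ht6 hc hex
    exact dominates_of_exit μ h t hP tP hμh htμ
  -- interpolation regime t' < μ: F(μ) ≥ 0 and the tight criterion
  have hreg : tP < μ := not_le.mp hex
  have hF : 0 ≤ (t - tP) * (hP - μ) - (hP - h) * (μ - tP) := by
    have e1 : t - tP = s * σ - u * π := by rw [ht]; ring
    have e2 : hP - h = u * σ := by rw [hh]; ring
    rw [e1, e2]
    rcases le_or_gt (m * u) q with hc | hc
    · have hμe : μ = m * u := by rw [hμ]; exact min_eq_left hc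
      rw [hμe] at hreg ⊢
      exact hubStep_F_caseA1 m u s d q H T σ π hm0 hs hd hu hq0 hqH hH1 hT0 hσ hC hc hreg
    · have hμe : μ = q := by rw [hμ]; exact min_eq_right hc.le
      rw [hμe] at hreg ⊢
      exact hubStep_F_caseA2 m u s d q H T σ π hm0 hm1 hs hd hu hu1 hqH hH1 hT0 hTH hσ hσ1 hC hc hreg
  -- μ < h' unless degenerate; in the degenerate case h = h' and t ≥ t'
  by_cases hlt : μ < hP
  · exact dominates_of_tight μ h t hP tP hμh hhle hlt hF
  · -- μ ≥ h' ≥ h ≥ μ: then uσ = 0, and (C) forces uπ·q(1−H) ≤ 0; we show t' ≤ t and use λ = 1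
    have hPe : hP = μ := le_antisymm (not_lt.mp hlt) (le_trans hμh hhle)
    have hhe : h = hP := le_antisymm hhle (by rw [hPe]; exact hμh)
    have huσ : u * σ = 0 := by rw [hh] at hhe; linarith
    -- μ ≤ mu ≤ h' = μ, so μ = mu, hence (1 - mu) H = 0
    have hμmu : μ ≤ m * u := by rw [hμ]; exact min_le_left _ _
    have hPge : m * u ≤ hP := by rw [hhP]; nlinarith [mul_nonneg (sub_nonneg.mpr hmu1) hH0]
    have hμe : μ = m * u := le_antisymm hμmu (by rw [← hPe]; exact hPge)
    -- t' < μ = mu: so mu > 0, hence u > 0 and σ = 0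
    have hmu_pos : 0 < m * u := by
      have h1 : 0 ≤ tP := by
        rw [htP]; exact add_nonneg (add_nonneg (mul_nonneg hm0 hd) (mul_nonneg (mul_nonneg hm0 hs) hH0))
          (mul_nonneg (by linarith) hT0)
      linarith
    have hu_pos : 0 < u := by
      rcases eq_or_lt_of_le hu0 with h0 | h0
      · exfalso; rw [← h0, mul_zero] at hmu_pos; exact lt_irrefl _ hmu_pos
      · exact h0
    have hσ0 : σ = 0 := by
      rcases mul_eq_zero.mp huσ with h0 | h0
      · exact absurd h0 (ne_of_gt hu_pos)
      · exact h0
    -- from (C): π q (1-H) ≤ 0; q ≥ mu > 0; if H < 1 then π = 0; if H = 1 then t' ≥ mu, contradiction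
    have hq_pos : 0 < q := by
      have : m * u ≤ q := by rw [← hμe, hμ]; exact min_le_right _ _
      linarith
    have hH_lt : H < 1 := by
      by_contra hHn
      have hH' : H = 1 := le_antisymm hH1 (not_lt.mp hHn)
      have : m * u ≤ tP := by
        rw [htP, hH', ← hu]; nlinarith [mul_nonneg (sub_nonneg.mpr hmu1) hT0]
      linarith
    have hπ0 : π = 0 := by
      have h1 : π * q * (1 - H) ≤ 0 := by rw [hσ0] at hC; simpa using hC
      have h2 : 0 ≤ π * q * (1 - H) := mul_nonneg (mul_nonneg hπ hq_pos.le) (by linarith)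
      have h3 : π * (q * (1 - H)) = 0 := by rw [← mul_assoc]; exact le_antisymm h1 h2
      rcases mul_eq_zero.mp h3 with h4 | h4
      · exact h4
      · exfalso; exact absurd h4 (ne_of_gt (mul_pos hq_pos (by linarith)))
    have hte : tP ≤ t := by rw [ht, hσ0, hπ0]; simp [htP]
    exact dominates_of_le μ h t hP tP (le_of_eq hhe.symm) hte

end Block

end Quant

end Summit.CriticalPhenomena.PercolationContinuityZ3.Theorems
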